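import Literature.Combinatorics.LorentzianPolynomials.HodgeRiemann
import HarnessLib

/-!
# The operator `1 + θ w_i ∂_j` preserves `L^d_n` (Brändén–Huh 2020, §2.2 Proposition 2.7, Lemma 2.8)

Layer `Literature/Combinatorics/LorentzianPolynomials`, namespace `Literature.Combinatorics.LorentzianPolynomials`;
lane `lit-hodgefound` (Track 2 foundations library), seat p16, generation 29 (row g29-#6). "The following proposition
plays a central role in our analysis of `L^d_n`" — it is the engine of the Nuij-type homotopy (Lemma 2.12, Theorem
2.13) and, in the source, of Theorem 2.10. The tree obtained Theorem 2.10 / Corollary 2.11 by a direct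
signature argument (`Substitution`, `HodgeRiemannCubic`, `HodgeRiemann`); this file proves Proposition 2.7 itself for
the tree's Definition-2.6 `lorentzian`, with the source's proof: Lemma 2.8 for the support (splitting, a box,
aggregation — the tree's `IsMConvex.preimage_mapDomain` / `image_mapDomain_of_any` of `MConvexMaps.lean` =
[KMT07, Lemmas 6 and 9]), and for the quadratics `∂^α g` the stability relation `≺` of Lemma 2.9 in the signature
language of `Literature.LinearAlgebra.QuadraticForm.LorentzianSignatureSum` (`sigPos_bordered_mulVec_le` = Lemma 2.9 (1),
`sigPos_add_le_one_of_isotropic` = Lemma 2.9 (4), pull-backs = Lemma 2.9 (2), (3)), the degenerate case being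
Corollary 2.11 for cubics (`sigPos_hessian_dirDeriv_le_one`).

## Source (verbatim) — P. Brändén, J. Huh, *Lorentzian polynomials* [BrandenHuh2019] (held `paper:arxiv-1902.03719`)

§2.2 (pp. 12–14): "We fix a degree `d` homogeneous polynomial `f` in `n` variables and indices `i, j` in `[n]`.
**Proposition 2.7.** If `f ∈ L^d_n`, then `(1 + θ w_i ∂_j) f ∈ L^d_n` for every nonnegative real number `θ`. We
prepare the proof of Proposition 2.7 with two lemmas. **Lemma 2.8.** If `f ∈ M^d_n`, then `(1 + θ w_i ∂_j) f ∈ M^d_n`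
for every nonnegative real number `θ`. *Proof.* We may suppose `θ = 1` and `j = n`. […] Introduce a new variable
`w_{n+1}`, and set `g(w_1, …, w_n, w_{n+1}) = f(w_1, …, w_n + w_{n+1})`. By [KMT07, Lemma 6], the support of `g` is
M-convex. […] Since the intersection of an M-convex set with a cartesian product of intervals is M-convex, it follows
that `(1 + w_{n+1} ∂_n) f ∈ M^d_{n+1}`. By [KMT07, Lemma 9], the above displayed inclusion implies
`(1 + w_i ∂_n) f ∈ M^d_n`. In terms of [KMT07], the support of `(1 + w_i ∂_n) f` is obtained from the support of
`(1 + w_{n+1} ∂_n) f` by an elementary aggregation […]. **Lemma 2.9.** Let `f, g_1, g_2, h_1, h_2` be stable polynomials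
satisfying `h_1 ≺ f ≺ g_1` and `h_2 ≺ f ≺ g_2`. (1) The derivative `∂_1 f` is stable and `∂_1 f ≺ f`. (2) The
diagonalization `f(w_1, w_1, w_3, …, w_n)` is stable. (3) The dilation `f(a_1 w_1, …, a_n w_n)` is stable for any
`a ∈ ℝ^n_{≥0}`. (4) If `f` is not identically zero, then `f ≺ θ_1 g_1 + θ_2 g_2` for any `θ_1, θ_2 ≥ 0`. […]
*Proof of Proposition 2.7.* When `d = 2`, Lemma 2.9 implies Proposition 2.7. Suppose `d ≥ 3`, and set
`g = (1 + θ w_i ∂_j) f`. By Lemma 2.8, the support of `g` is M-convex. Therefore, it is enough to prove that `∂^α g` is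
stable for all `α ∈ Δ^{d-2}_n`. We give separate arguments when `α_i = 0` and `α_i > 0`. If `α_i = 0`, then
`∂^α g = ∂^α f + θ w_i ∂^{α+e_j} f`. In this case, (1), (2), and (3) of Lemma 2.9 for `∂^α f` show that `∂^α g` is
stable. If `α_i > 0`, then `∂^α g = ∂^α f + θ α_i ∂^{α-e_i+e_j} f + θ w_i ∂^{α+e_j} f
= ∂_i(∂^{α-e_i} f) + θ α_i ∂_j(∂^{α-e_i} f) + θ w_i ∂_i∂_j(∂^{α-e_i} f)`. In this case, (1) of Lemma 2.9 applies to
the stable polynomials `∂^α f` and `∂^{α-e_i+e_j} f`: `∂_i∂_j(∂^{α-e_i} f) ≺ ∂_i(∂^{α-e_i} f)` and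
`∂_i∂_j(∂^{α-e_i} f) ≺ ∂_j(∂^{α-e_i} f)`. Therefore, unless `∂^{α+e_j} f` is identically zero, `∂^α g` is stable by
(2) and (4) of Lemma 2.9. It remains to prove that, whenever `α_i` is positive and `∂^{α+e_j} f` is identically zero,
`∂_i(∂^{α-e_i} f) + φ ∂_j(∂^{α-e_i} f)` is stable for every nonnegative real number `φ`. Since the cubic form
`∂^{α-e_i} f` is in `L^3_n`, it is enough to prove the statement when `d = 3` and `α = e_i`. […]"

## What is here

* §1 the operator `oneAddXPderiv θ i j f = f + θ · w_i ∂_j f`, its coefficients and normalized coefficients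
  **`c_β((1 + θ w_i ∂_j) f) = c_β(f) + θ β_i c_{β-e_i+e_j}(f)`**, homogeneity, nonnegativity, support.
* §2 **Lemma 2.8** (`isMConvex_support_oneAddXPderiv`): the support `supp f ∪ (supp f - e_j + e_i)` is the aggregation
  `w_{n+1} ↦ w_i` of the box `{β_{n+1} ≤ 1}` in the splitting `w_j ↦ w_j + w_{n+1}` of `supp f`
  (`IsMConvex.sep_apply_le`: M-convex sets meet coordinate half-spaces in M-convex sets).
* §3 the Hessians of the quadratics `∂^α g`: `𝓗_{∂^α g} = 𝓗_{∂^α f} + θ α_i 𝓗_{∂^{α-e_i+e_j} f} + θ (e_i uᵀ + u e_iᵀ)`,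
  `u = ∇ ∂^{α+e_j} f = 𝓗_{∂^α f} e_j = 𝓗_{∂^{α-e_i+e_j} f} e_i` (`borderUpdate`), realised as a pull-back of the bordered
  form `[[𝓗, v], [vᵀ, 0]]` of `LorentzianSignatureSum` along `x ↦ (x, t x_i)` (`liftLineMap`; Lemma 2.9 (2), (3)), and
  the two signature steps: one bordering (Lemma 2.9 (1)) and the isotropic sum of two borderings (Lemma 2.9 (4)).
* §4 **Proposition 2.7** (`oneAddXPderiv_mem_lorentzian`): the three printed cases — `α_i = 0`; `α_i > 0` and
  `∂^{α+e_j} f ≠ 0`; `α_i > 0` and `∂^{α+e_j} f = 0` (Cor. 2.11 for the cubic `∂^{α-e_i} f`) — and the iterate over a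
  list of operators (`foldr_oneAddXPderiv_mem_lorentzian`, for the homotopies of §2.3).

Three definitions with bodies (`oneAddXPderiv`, the auxiliary linear map `liftLineMap`, the matrix `borderUpdate`),
theorems otherwise; no `sorry`, no named fact (net debt 0).

## References

* [BrandenHuh2019] P. Brändén, J. Huh, *Lorentzian polynomials*, Ann. of Math. (2) 192 (2020) 821–891, arXiv:1902.03719 —
  §2.2 Prop. 2.7, Lemma 2.8, Lemma 2.9 (pp. 12–14); §2.2 Cor. 2.11.
-/

noncomputable section

open MvPolynomial Finsupp Finset
open Literature.LinearAlgebra.QuadraticForm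

namespace Literature.Combinatorics.LorentzianPolynomials

variable {σ : Type*}

/-! ## §1 The operator `1 + θ w_i ∂_j` and its coefficients -/

section Operator

/-- **The operator `(1 + θ w_i ∂_j)`** of Proposition 2.7: `f ↦ f + θ · w_i · ∂_j f`.
[cite: BrandenHuh2019, §2.2 Prop. 2.7 (p. 12)] -/
def oneAddXPderiv (θ : ℝ) (i j : σ) (f : MvPolynomial σ ℝ) : MvPolynomial σ ℝ := f + θ • (X i * pderiv j f)

/-- `(1 + θ w_i ∂_j) f` unfolded. [cite: BrandenHuh2019, §2.2 Prop. 2.7] -/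
theorem oneAddXPderiv_def (θ : ℝ) (i j : σ) (f : MvPolynomial σ ℝ) :
    oneAddXPderiv θ i j f = f + θ • (X i * pderiv j f) := rfl

/-- `(1 + 0 · w_i ∂_j) f = f`. [cite: BrandenHuh2019, §2.2 Prop. 2.7] -/
theorem oneAddXPderiv_zero (i j : σ) (f : MvPolynomial σ ℝ) : oneAddXPderiv 0 i j f = f := by
  rw [oneAddXPderiv, zero_smul, add_zero]

/-- `(1 + θ w_i ∂_j)` is additive. [cite: BrandenHuh2019, §2.2 Prop. 2.7 (a linear operator)] -/
theorem oneAddXPderiv_add (θ : ℝ) (i j : σ) (f g : MvPolynomial σ ℝ) :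
    oneAddXPderiv θ i j (f + g) = oneAddXPderiv θ i j f + oneAddXPderiv θ i j g := by
  simp only [oneAddXPderiv, map_add, mul_add, smul_add]
  abel

/-- `(1 + θ w_i ∂_j)` commutes with scalars. [cite: BrandenHuh2019, §2.2 Prop. 2.7 (a linear operator)] -/
theorem oneAddXPderiv_smul (θ : ℝ) (i j : σ) (c : ℝ) (f : MvPolynomial σ ℝ) :
    oneAddXPderiv θ i j (c • f) = c • oneAddXPderiv θ i j f := by
  rw [oneAddXPderiv, oneAddXPderiv, Derivation.map_smul, mul_smul_comm, smul_add, smul_comm c θ]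

/-- `(1 + θ w_i ∂_j) f` has nonnegative coefficients when `f` has and `θ ≥ 0`. [cite: BrandenHuh2019, §2.2 Lemma 2.8
("`∈ M^d_n`", a subset of `ℝ_{≥0}[w]`)] -/
theorem coeff_oneAddXPderiv_nonneg {θ : ℝ} (hθ : 0 ≤ θ) (i j : σ) {f : MvPolynomial σ ℝ} (hf : ∀ β, 0 ≤ coeff β f)
    (β : σ →₀ ℕ) : 0 ≤ coeff β (oneAddXPderiv θ i j f) := by
  classical
  rw [oneAddXPderiv, coeff_add, coeff_smul, smul_eq_mul, coeff_X_mul']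
  refine add_nonneg (hf β) (mul_nonneg hθ ?_)
  split_ifs
  · exact coeff_pderiv_nonneg hf j _
  · exact le_rfl

/-- `(1 + θ w_i ∂_j)` preserves `H^d_n`. [cite: BrandenHuh2019, §2.2 Prop. 2.7 ("a degree `d` homogeneous polynomial")] -/
theorem isHomogeneous_oneAddXPderiv (θ : ℝ) (i j : σ) {f : MvPolynomial σ ℝ} {d : ℕ} (hf : f.IsHomogeneous d) :
    (oneAddXPderiv θ i j f).IsHomogeneous d := by
  rw [oneAddXPderiv, smul_eq_C_mul]
  refine hf.add ?_
  rcases Nat.eq_zero_or_pos d with hd | hd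
  · subst hd
    have hC : f = C (coeff 0 f) := totalDegree_eq_zero_iff_eq_C.1 (Nat.le_zero.1 hf.totalDegree_le)
    rw [hC, pderiv_C, mul_zero, mul_zero]
    exact isHomogeneous_zero σ ℝ 0
  · have h := (isHomogeneous_C σ θ).mul ((isHomogeneous_X ℝ i).mul (hf.pderiv (i := j)))
    rwa [show 0 + (1 + (d - 1)) = d by omega] at h

/-- **The support of `(1 + θ w_i ∂_j) f`** (`θ > 0`, `f ∈ ℝ_{≥0}[w]`): `supp f ∪ {β : β_i > 0, β - e_i + e_j ∈ supp f}`.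
[cite: BrandenHuh2019, §2.2 proof of Lemma 2.8 ("the support of `(1 + w_i ∂_n) f` is obtained from the support of
`(1 + w_{n+1} ∂_n) f` by an elementary aggregation")] -/
theorem coeff_oneAddXPderiv_ne_zero_iff {θ : ℝ} (hθ : 0 < θ) (i j : σ) {f : MvPolynomial σ ℝ}
    (hf : ∀ β, 0 ≤ coeff β f) (β : σ →₀ ℕ) :
    coeff β (oneAddXPderiv θ i j f) ≠ 0 ↔
      coeff β f ≠ 0 ∨ (β i ≠ 0 ∧ coeff (β - Finsupp.single i 1 + Finsupp.single j 1) f ≠ 0) := by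
  classical
  -- for `a, b ≥ 0`: `a + θ b ≠ 0 ↔ a ≠ 0 ∨ b ≠ 0`
  have hsum : ∀ {a b : ℝ}, 0 ≤ a → 0 ≤ b → (a + θ * b ≠ 0 ↔ a ≠ 0 ∨ b ≠ 0) := fun {a b} ha hb ↦ by
    constructor
    · intro h
      by_contra hno
      rw [not_or, not_ne_iff, not_ne_iff] at hno
      exact h (by rw [hno.1, hno.2, mul_zero, add_zero])
    · intro hab h0
      obtain ⟨ha0, hb0⟩ := (add_eq_zero_iff_of_nonneg ha (mul_nonneg hθ.le hb)).1 h0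
      rcases hab with h | h
      · exact h ha0
      · exact h ((mul_eq_zero.1 hb0).resolve_left hθ.ne')
  rw [oneAddXPderiv, coeff_add, coeff_smul, smul_eq_mul, coeff_X_mul']
  by_cases hβ : β i = 0
  · rw [if_neg (by rw [Finsupp.mem_support_iff]; exact fun h ↦ h hβ), mul_zero, add_zero]
    simp [hβ]
  · rw [if_pos (Finsupp.mem_support_iff.2 hβ), hsum (hf β) (coeff_pderiv_nonneg hf j _), coeff_pderiv,
      mul_ne_zero_iff, and_iff_left (by positivity)]
    simp [hβ]

variable [Fintype σ]

/-- **`c_β(w_i ∂_j f) = β_i · c_{β-e_i+e_j}(f)`** (normalized coefficients `c_β = β! coeff_β`; for `β_i = 0` both sides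
vanish). [cite: BrandenHuh2019, §2.2 proof of Prop. 2.7 ("`∂^α g = ∂^α f + θ α_i ∂^{α-e_i+e_j} f + θ w_i ∂^{α+e_j} f`")] -/
theorem normCoeff_X_mul_pderiv (i j : σ) (f : MvPolynomial σ ℝ) (β : σ →₀ ℕ) :
    normCoeff β (X i * pderiv j f) = β i * normCoeff (β - Finsupp.single i 1 + Finsupp.single j 1) f := by
  classical
  rw [normCoeff_def, coeff_X_mul']
  by_cases hβ : β i = 0
  · rw [if_neg (by rw [Finsupp.mem_support_iff]; exact fun h ↦ h hβ), hβ, Nat.cast_zero, zero_mul, mul_zero]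
  · rw [if_pos (Finsupp.mem_support_iff.2 hβ), coeff_pderiv, normCoeff_def, factorialProd_add_single]
    have h1 : factorialProd β =
        factorialProd (β - Finsupp.single i 1) * ((β - Finsupp.single i 1 : σ →₀ ℕ) i + 1) := by
      conv_lhs => rw [← Finsupp.sub_add_single_one_cancel hβ]
      rw [factorialProd_add_single]
    have h2 : (((β - Finsupp.single i 1 : σ →₀ ℕ) i : ℝ) + 1) = β i := by
      rw [Finsupp.tsub_apply, Finsupp.single_eq_same]
      have : 1 ≤ β i := Nat.one_le_iff_ne_zero.2 hβ
      rw [Nat.cast_sub this, Nat.cast_one]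
      ring
    rw [h1, h2]
    ring

/-- **`c_β((1 + θ w_i ∂_j) f) = c_β(f) + θ β_i c_{β-e_i+e_j}(f)`.** [cite: BrandenHuh2019, §2.2 proof of Prop. 2.7] -/
theorem normCoeff_oneAddXPderiv (θ : ℝ) (i j : σ) (f : MvPolynomial σ ℝ) (β : σ →₀ ℕ) :
    normCoeff β (oneAddXPderiv θ i j f) =
      normCoeff β f + θ * (β i * normCoeff (β - Finsupp.single i 1 + Finsupp.single j 1) f) := by
  rw [oneAddXPderiv, normCoeff_add, normCoeff_smul, normCoeff_X_mul_pderiv]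

end Operator

/-! ## §2 Lemma 2.8: the support stays M-convex -/

section Support

/-- **An M-convex set meets a coordinate half-space `{α_m ≤ c}` in an M-convex set** ("the intersection of an M-convex
set with a cartesian product of intervals is M-convex": the exchange partner `α - e_i + e_j` raises coordinate `m`
only when `j = m`, and then `α_m + 1 ≤ β_m ≤ c`). [cite: BrandenHuh2019, §2.2 proof of Lemma 2.8 (p. 12)] -/
theorem IsMConvex.sep_apply_le {τ : Type*} {J : Set (τ →₀ ℕ)} (hJ : IsMConvex J) (m : τ) (c : ℕ) :
    IsMConvex {α | α ∈ J ∧ α m ≤ c} := by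
  classical
  rintro α β ⟨hα, hαm⟩ ⟨hβ, hβm⟩ i hi
  obtain ⟨j, hj, hmem⟩ := hJ hα hβ i hi
  refine ⟨j, hj, hmem, ?_⟩
  show (α - Finsupp.single i 1 + Finsupp.single j 1 : τ →₀ ℕ) m ≤ c
  rw [Finsupp.add_apply, Finsupp.tsub_apply]
  by_cases hjm : j = m
  · subst hjm
    rw [Finsupp.single_eq_same]
    omega
  · rw [Finsupp.single_eq_of_ne' hjm]
    omega

/-- Splitting `w_k ↦ w_k + w_{n+1}` read on exponents: for `ζ ∈ ℕ^{n+1}`, pushing forward along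
`n + 1 ↦ k` gives `ζ|_{[n]} + ζ_{n+1} e_k`. [cite: BrandenHuh2019, §2.2 proof of Lemma 2.8 ("`g(w_1, …, w_n, w_{n+1}) =
f(w_1, …, w_n + w_{n+1})`")] -/
theorem mapDomain_optionElim (k : σ) (ζ : Option σ →₀ ℕ) :
    Finsupp.mapDomain (fun o : Option σ ↦ o.elim k id) ζ = ζ.some + Finsupp.single k (ζ none) := by
  classical
  have hζ : ζ = Finsupp.mapDomain Option.some ζ.some + Finsupp.single none (ζ none) := by
    ext o
    cases o with
    | none =>
      rw [Finsupp.add_apply, Finsupp.mapDomain_notin_range _ _ (by simp), Finsupp.single_eq_same, zero_add]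
    | some a =>
      rw [Finsupp.add_apply, Finsupp.mapDomain_apply (Option.some_injective σ), Finsupp.some_apply,
        Finsupp.single_eq_of_ne (Option.some_ne_none a), add_zero]
  conv_lhs => rw [hζ]
  rw [Finsupp.mapDomain_add, Finsupp.mapDomain_single, ← Finsupp.mapDomain_comp]
  have hcomp : ((fun o : Option σ ↦ o.elim k id) ∘ Option.some) = id := funext fun _ ↦ rfl
  rw [hcomp, Finsupp.mapDomain_id]
  rfl

/-- **Lemma 2.8 on the support sets**: if `J ⊆ ℕ^n` is M-convex then so is `J ∪ {β : β_i > 0, β - e_i + e_j ∈ J}` —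
the aggregation `w_{n+1} ↦ w_i` ([KMT07, Lemma 9], `IsMConvex.image_mapDomain_of_any`) of the box `{ζ_{n+1} ≤ 1}`
(`IsMConvex.sep_apply_le`) in the splitting `w_j ↦ w_j + w_{n+1}` of `J` ([KMT07, Lemma 6],
`IsMConvex.preimage_mapDomain`). [cite: BrandenHuh2019, §2.2 Lemma 2.8 and its proof (p. 12)] -/
theorem IsMConvex.union_shift [Fintype σ] {J : Set (σ →₀ ℕ)} (hJ : IsMConvex J) (i j : σ) :
    IsMConvex {β : σ →₀ ℕ | β ∈ J ∨ (β i ≠ 0 ∧ β - Finsupp.single i 1 + Finsupp.single j 1 ∈ J)} := by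
  classical
  set S : Set (Option σ →₀ ℕ) :=
    {ζ | ζ ∈ {ζ : Option σ →₀ ℕ | Finsupp.mapDomain (fun o : Option σ ↦ o.elim j id) ζ ∈ J} ∧ ζ none ≤ 1} with hS
  have hSM : IsMConvex S := (hJ.preimage_mapDomain _).sep_apply_le none 1
  have himage : Finsupp.mapDomain (fun o : Option σ ↦ o.elim i id) '' S =
      {β : σ →₀ ℕ | β ∈ J ∨ (β i ≠ 0 ∧ β - Finsupp.single i 1 + Finsupp.single j 1 ∈ J)} := by
    ext β
    simp only [hS, Set.mem_image, Set.mem_setOf_eq]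
    constructor
    · rintro ⟨ζ, ⟨hζJ, hζ1⟩, rfl⟩
      rw [mapDomain_optionElim] at hζJ ⊢
      rcases Nat.le_one_iff_eq_zero_or_eq_one.1 hζ1 with h0 | h1
      · rw [h0, Finsupp.single_zero, add_zero] at hζJ ⊢
        exact Or.inl hζJ
      · rw [h1] at hζJ ⊢
        refine Or.inr ⟨by simp [Finsupp.add_apply], ?_⟩
        rwa [add_tsub_cancel_right]
    · rintro (hβ | ⟨hβi, hβJ⟩)
      · refine ⟨β.optionElim 0, ⟨?_, ?_⟩, ?_⟩
        · rw [mapDomain_optionElim, Finsupp.some_optionElim, Finsupp.optionElim_apply_none, Finsupp.single_zero,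
            add_zero]
          exact hβ
        · exact (Finsupp.optionElim_apply_none _ _).trans_le (Nat.zero_le _)
        · rw [mapDomain_optionElim, Finsupp.some_optionElim, Finsupp.optionElim_apply_none, Finsupp.single_zero,
            add_zero]
      · refine ⟨(β - Finsupp.single i 1).optionElim 1, ⟨?_, ?_⟩, ?_⟩
        · rw [mapDomain_optionElim, Finsupp.some_optionElim, Finsupp.optionElim_apply_none]
          exact hβJ
        · exact (Finsupp.optionElim_apply_none _ _).le
        · rw [mapDomain_optionElim, Finsupp.some_optionElim, Finsupp.optionElim_apply_none,
            Finsupp.sub_add_single_one_cancel hβi]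
  rw [← himage]
  exact hSM.image_mapDomain_of_any _

/-- **Brändén–Huh, Lemma 2.8: "If `f ∈ M^d_n`, then `(1 + θ w_i ∂_j) f ∈ M^d_n` for every nonnegative real number
`θ`."** (For `θ = 0` nothing changes; for `θ > 0` the support is `supp f ∪ {β : β_i > 0, β - e_i + e_j ∈ supp f}`.)
[cite: BrandenHuh2019, §2.2 Lemma 2.8 (p. 12)] -/
theorem isMConvex_support_oneAddXPderiv [Fintype σ] {θ : ℝ} (hθ : 0 ≤ θ) (i j : σ) {f : MvPolynomial σ ℝ}
    (hf : ∀ β, 0 ≤ coeff β f) (hM : IsMConvex {β | coeff β f ≠ 0}) :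
    IsMConvex {β | coeff β (oneAddXPderiv θ i j f) ≠ 0} := by
  rcases hθ.eq_or_lt with h | hθ'
  · rw [← h, oneAddXPderiv_zero]
    exact hM
  · have hset : {β | coeff β (oneAddXPderiv θ i j f) ≠ 0} =
        {β : σ →₀ ℕ | β ∈ {γ : σ →₀ ℕ | coeff γ f ≠ 0} ∨
          (β i ≠ 0 ∧ β - Finsupp.single i 1 + Finsupp.single j 1 ∈ {γ : σ →₀ ℕ | coeff γ f ≠ 0})} := by
      ext β
      simp only [Set.mem_setOf_eq]
      exact coeff_oneAddXPderiv_ne_zero_iff hθ' i j hf β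
    rw [hset]
    exact hM.union_shift i j

end Support

/-! ## §3 The Hessians of the quadratics `∂^α (1 + θ w_i ∂_j) f`: bordering and pull-back -/

section Hessians

/-- **The diagonalization/dilation `w_{n+1} = t w_i` as a linear map** `x ↦ (x, t x_i)` from `ℝ^n` to `ℝ^{n+1}`
(Lemma 2.9 (2), (3): pulling a form back along it does not raise the positive index). [cite: BrandenHuh2019, §2.2
Lemma 2.9 (2), (3) and the proof of Prop. 2.7] -/
def liftLineMap (t : ℝ) (i : σ) : (σ → ℝ) →ₗ[ℝ] (Option σ → ℝ) where
  toFun x := fun o ↦ o.elim (t * x i) x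
  map_add' x y := by
    ext o
    cases o with
    | none =>
      show t * (x + y) i = t * x i + t * y i
      rw [Pi.add_apply, mul_add]
    | some a => rfl
  map_smul' c x := by
    ext o
    cases o with
    | none =>
      show t * (c • x) i = c * (t * x i)
      rw [Pi.smul_apply, smul_eq_mul, mul_left_comm]
    | some a => rfl

/-- `liftLineMap t i x` at `n + 1` is `t x_i`. [cite: BrandenHuh2019, §2.2 Lemma 2.9 (2), (3)] -/
@[simp] theorem liftLineMap_none (t : ℝ) (i : σ) (x : σ → ℝ) : liftLineMap t i x none = t * x i := rfl

/-- `liftLineMap t i x` at `k ≤ n` is `x_k`. [cite: BrandenHuh2019, §2.2 Lemma 2.9 (2), (3)] -/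
@[simp] theorem liftLineMap_some (t : ℝ) (i : σ) (x : σ → ℝ) (k : σ) : liftLineMap t i x (Option.some k) = x k :=
  rfl

variable [DecidableEq σ]

/-- **`H + t (e_i vᵀ + v e_iᵀ)`**: the Hessian of the quadratic form `½ xᵀHx + t x_i (vᵀx)` — for Brändén–Huh, the
Hessian of `∂^α f + θ α_i ∂^{α-e_i+e_j} f + θ w_i ∂^{α+e_j} f` with `v = ∇ ∂^{α+e_j} f`.
[cite: BrandenHuh2019, §2.2 proof of Prop. 2.7 ("`θ w_i ∂^{α+e_j} f`")] -/
def borderUpdate (H : Matrix σ σ ℝ) (t : ℝ) (i : σ) (v : σ → ℝ) : Matrix σ σ ℝ :=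
  Matrix.of fun a b ↦ H a b + t * ((if a = i then v b else 0) + (if b = i then v a else 0))

/-- The entries of `H + t (e_i vᵀ + v e_iᵀ)`. [cite: BrandenHuh2019, §2.2 proof of Prop. 2.7] -/
theorem borderUpdate_apply (H : Matrix σ σ ℝ) (t : ℝ) (i : σ) (v : σ → ℝ) (a b : σ) :
    borderUpdate H t i v a b = H a b + t * ((if a = i then v b else 0) + (if b = i then v a else 0)) := rfl

/-- `H + t (e_i vᵀ + v e_iᵀ) = H + (t/2) (e_i (2v)ᵀ + (2v) e_iᵀ)`. [cite: BrandenHuh2019, §2.2 Lemma 2.9 (3) (dilation)] -/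
theorem borderUpdate_half_two (H : Matrix σ σ ℝ) (t : ℝ) (i : σ) (v : σ → ℝ) :
    borderUpdate H t i v = borderUpdate H (t / 2) i (v + v) := by
  ext a b
  simp only [borderUpdate_apply, Pi.add_apply]
  split_ifs <;> ring

variable [Fintype σ]

/-- Pulling the bordered form `[[H, v], [vᵀ, 0]]` back along `x ↦ (x, t x_i)`:
`xᵀHy + t y_i (vᵀx) + t x_i (vᵀy)`. [cite: BrandenHuh2019, §2.2 proof of Prop. 2.7 (Lemma 2.9 (2), (3))] -/
theorem toBilin'_bordered_liftLineMap (H : Matrix σ σ ℝ) (v : σ → ℝ) (t : ℝ) (i : σ) (x y : σ → ℝ) :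
    Matrix.toBilin' (bordered H v) (liftLineMap t i x) (liftLineMap t i y) =
      Matrix.toBilin' H x y + t * y i * (∑ a, v a * x a) + t * x i * (∑ a, v a * y a) := by
  rw [toBilin'_bordered]
  simp only [liftLineMap_none, liftLineMap_some]

/-- The quadratic form of `H + t (e_i vᵀ + v e_iᵀ)`: `xᵀHy + t y_i (vᵀx) + t x_i (vᵀy)` — the same as the pull-back of
`[[H, v], [vᵀ, 0]]` along `x ↦ (x, t x_i)`. [cite: BrandenHuh2019, §2.2 proof of Prop. 2.7 ("`θ w_i ∂^{α+e_j} f`")] -/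
theorem toBilin'_borderUpdate (H : Matrix σ σ ℝ) (t : ℝ) (i : σ) (v : σ → ℝ) (x y : σ → ℝ) :
    Matrix.toBilin' (borderUpdate H t i v) x y =
      Matrix.toBilin' H x y + t * y i * (∑ a, v a * x a) + t * x i * (∑ a, v a * y a) := by
  have h1 : ∀ a b, x a * borderUpdate H t i v a b * y b =
      x a * H a b * y b + t * (x a * (if a = i then v b else 0) * y b) +
        t * (x a * (if b = i then v a else 0) * y b) := fun a b ↦ by
    rw [borderUpdate_apply]; ring
  have h2 : ∑ a, ∑ b, x a * (if a = i then v b else 0) * y b = x i * ∑ b, v b * y b := by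
    rw [Finset.sum_eq_single_of_mem i (Finset.mem_univ i) (fun a _ ha ↦ by simp [ha]), Finset.mul_sum]
    exact Finset.sum_congr rfl fun b _ ↦ by rw [if_pos rfl]; ring
  have h3 : ∑ a, ∑ b, x a * (if b = i then v a else 0) * y b = y i * ∑ a, v a * x a := by
    rw [Finset.mul_sum]
    refine Finset.sum_congr rfl fun a _ ↦ ?_
    rw [Finset.sum_eq_single_of_mem i (Finset.mem_univ i) (fun b _ hb ↦ by simp [hb]), if_pos rfl]
    ring
  simp only [Matrix.toBilin'_apply, h1, Finset.sum_add_distrib, ← Finset.mul_sum]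
  rw [h2, h3]
  ring

/-- **Lemma 2.9 (2), (3) for `H + t (e_i vᵀ + v e_iᵀ)`**: its positive index is at most that of `[[H, v], [vᵀ, 0]]`
(a pull-back along the linear map `x ↦ (x, t x_i)`). [cite: BrandenHuh2019, §2.2 Lemma 2.9 (2), (3); proof of Prop. 2.7]
[cite: Serre1973, Ch. V §1.3.2] -/
theorem sigPos_borderUpdate_le (H : Matrix σ σ ℝ) (t : ℝ) (i : σ) (v : σ → ℝ) :
    sigPos (Matrix.toBilin' (borderUpdate H t i v)).toQuadraticMap ≤
      sigPos (Matrix.toBilin' (bordered H v)).toQuadraticMap :=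
  LinearMap.BilinForm.sigPos_le_sigPos_of_comp _ _ (liftLineMap t i) fun x y ↦ by
    rw [toBilin'_bordered_liftLineMap, toBilin'_borderUpdate]

/-- **One bordering (the case `α_i = 0`, and the degenerate case `∂^{α+e_j} f = 0`)**: if `M` is symmetric with at
most one positive square and `u = Mb` with `bᵀMb ≥ 0`, then `M + t (e_i uᵀ + u e_iᵀ)` has at most one positive square —
`∂^α f + θ w_i ∂^{α+e_j} f` from `∂^{α+e_j} f = ∂_j ∂^α f ≺ ∂^α f` (Lemma 2.9 (1): `sigPos_bordered_mulVec_le`) by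
diagonalization and dilation (Lemma 2.9 (2), (3): `sigPos_borderUpdate_le`).
[cite: BrandenHuh2019, §2.2 proof of Prop. 2.7, case `α_i = 0` ("(1), (2), and (3) of Lemma 2.9 for `∂^α f`")] -/
theorem sigPos_borderUpdate_le_one_of_mulVec {M : Matrix σ σ ℝ} (hM : M.IsSymm)
    (h1 : sigPos (Matrix.toBilin' M).toQuadraticMap ≤ 1) {b u : σ → ℝ} (hb : 0 ≤ Matrix.toBilin' M b b)
    (hu : M.mulVec b = u) (t : ℝ) (i : σ) :
    sigPos (Matrix.toBilin' (borderUpdate M t i u)).toQuadraticMap ≤ 1 := by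
  subst hu
  exact (sigPos_borderUpdate_le M t i _).trans ((sigPos_bordered_mulVec_le M hM hb).trans h1)

/-- **Two borderings (the case `α_i > 0`, `∂^{α+e_j} f ≠ 0`)**: if `M`, `N` are symmetric with at most one positive
square each and `u = Mb₁ = Nb₂ ≠ 0` with `b₁ᵀMb₁, b₂ᵀNb₂ ≥ 0`, then `M + N + t (e_i uᵀ + u e_iᵀ)` has at most one positive
square: `[[M, u], [uᵀ, 0]]` and `[[N, u], [uᵀ, 0]]` have at most one positive square (Lemma 2.9 (1)), share the isotropic
vector `e_{n+1}` and the functional `u`, so `[[M + N, 2u], [2uᵀ, 0]]` has at most one positive square (Lemma 2.9 (4):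
`sigPos_add_le_one_of_isotropic`), and `M + N + t (e_i uᵀ + u e_iᵀ)` is its pull-back along `x ↦ (x, (t/2) x_i)`
(Lemma 2.9 (2), (3)). For Brändén–Huh: `M = 𝓗(∂^α f)`, `N = θ α_i 𝓗(∂^{α-e_i+e_j} f)`, `u = ∇ ∂^{α+e_j} f`, `t = θ`.
[cite: BrandenHuh2019, §2.2 proof of Prop. 2.7, case `α_i > 0` ("`∂^α g` is stable by (2) and (4) of Lemma 2.9")] -/
theorem sigPos_borderUpdate_add_le_one {M N : Matrix σ σ ℝ} (hM : M.IsSymm) (hN : N.IsSymm)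
    (h1M : sigPos (Matrix.toBilin' M).toQuadraticMap ≤ 1) (h1N : sigPos (Matrix.toBilin' N).toQuadraticMap ≤ 1)
    {b₁ b₂ u : σ → ℝ} (hb₁ : 0 ≤ Matrix.toBilin' M b₁ b₁) (hb₂ : 0 ≤ Matrix.toBilin' N b₂ b₂)
    (hMu : M.mulVec b₁ = u) (hNu : N.mulVec b₂ = u) (hu0 : u ≠ 0) (t : ℝ) (i : σ) :
    sigPos (Matrix.toBilin' (borderUpdate (M + N) t i u)).toQuadraticMap ≤ 1 := by
  have hM' := sigPos_bordered_mulVec_le M hM hb₁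
  have hN' := sigPos_bordered_mulVec_le N hN hb₂
  rw [hMu] at hM'
  rw [hNu] at hN'
  obtain ⟨a₀, ha₀⟩ := Function.ne_iff.1 hu0
  have key := sigPos_add_le_one_of_isotropic (Matrix.toBilin' (bordered M u)) (Matrix.toBilin' (bordered N u))
    (isSymm_toBilin'_of_isSymm (isSymm_bordered hM _)) (isSymm_toBilin'_of_isSymm (isSymm_bordered hN _))
    (hM'.trans h1M) (hN'.trans h1N) (e := Pi.single none 1) (y₀ := Pi.single (Option.some a₀) 1)
    (toBilin'_bordered_none_none M _) (toBilin'_bordered_none_none N _)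
    (fun z ↦ by rw [toBilin'_bordered_none, toBilin'_bordered_none])
    (by
      rw [toBilin'_bordered_none, Finset.sum_eq_single a₀]
      · simpa using ha₀
      · intro c _ hc
        rw [Pi.single_apply, if_neg (fun h ↦ hc (Option.some_injective _ h)), mul_zero]
      · intro h; exact absurd (Finset.mem_univ _) h)
  rw [← map_add, bordered_add] at key
  rw [borderUpdate_half_two]
  exact (sigPos_borderUpdate_le _ _ _ _).trans key

/-- **The Hessian of `∂^α (1 + θ w_i ∂_j) f`, entrywise**:
`c_{α+e_a+e_b}(g) = c_{α+e_a+e_b}(f) + θ α_i c_{α-e_i+e_j+e_a+e_b}(f) + θ([a=i] u_b + [b=i] u_a)`, `u_k = c_{α+e_j+e_k}(f)`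
— the source's `∂^α g = ∂^α f + θ α_i ∂^{α-e_i+e_j} f + θ w_i ∂^{α+e_j} f` read on Hessians.
[cite: BrandenHuh2019, §2.2 proof of Prop. 2.7 (p. 13)] -/
theorem normCoeff_oneAddXPderiv_add_single_add_single (θ : ℝ) (i j : σ) (f : MvPolynomial σ ℝ) (α : σ →₀ ℕ)
    (a b : σ) :
    normCoeff (α + Finsupp.single a 1 + Finsupp.single b 1) (oneAddXPderiv θ i j f) =
      normCoeff (α + Finsupp.single a 1 + Finsupp.single b 1) f +
        θ * α i * normCoeff (α - Finsupp.single i 1 + Finsupp.single j 1 + Finsupp.single a 1 +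
          Finsupp.single b 1) f +
        θ * ((if a = i then normCoeff (α + Finsupp.single j 1 + Finsupp.single b 1) f else 0) +
          (if b = i then normCoeff (α + Finsupp.single j 1 + Finsupp.single a 1) f else 0)) := by
  rw [normCoeff_oneAddXPderiv]
  -- `(α + e_a + e_b)_i = α_i + [a = i] + [b = i]`
  have h1 : (((α + Finsupp.single a 1 + Finsupp.single b 1 : σ →₀ ℕ) i : ℕ) : ℝ) =
      α i + (if a = i then 1 else 0) + (if b = i then 1 else 0) := by
    simp only [Finsupp.add_apply, Finsupp.single_apply, Nat.cast_add, Nat.cast_ite, Nat.cast_one, Nat.cast_zero]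
  -- the three pieces of `(α_i + [a = i] + [b = i]) c_{α+e_a+e_b-e_i+e_j}(f)`
  have h2 : (α i : ℝ) * normCoeff (α + Finsupp.single a 1 + Finsupp.single b 1 - Finsupp.single i 1 +
        Finsupp.single j 1) f =
      α i * normCoeff (α - Finsupp.single i 1 + Finsupp.single j 1 + Finsupp.single a 1 + Finsupp.single b 1) f := by
    rcases eq_or_ne (α i) 0 with h0 | h0
    · rw [h0, Nat.cast_zero, zero_mul, zero_mul]
    · congr 2
      conv_lhs => rw [← Finsupp.sub_add_single_one_cancel h0]
      rw [add_right_comm (α - Finsupp.single i 1) (Finsupp.single i 1) (Finsupp.single a 1),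
        add_right_comm (α - Finsupp.single i 1 + Finsupp.single a 1) (Finsupp.single i 1) (Finsupp.single b 1),
        add_tsub_cancel_right,
        add_right_comm (α - Finsupp.single i 1 + Finsupp.single a 1) (Finsupp.single b 1) (Finsupp.single j 1),
        add_right_comm (α - Finsupp.single i 1) (Finsupp.single a 1) (Finsupp.single j 1)]
  have h3 : (if a = i then (1 : ℝ) else 0) * normCoeff (α + Finsupp.single a 1 + Finsupp.single b 1 -
        Finsupp.single i 1 + Finsupp.single j 1) f =
      if a = i then normCoeff (α + Finsupp.single j 1 + Finsupp.single b 1) f else 0 := by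
    split_ifs with hai
    · rw [one_mul, hai, add_right_comm α (Finsupp.single i 1) (Finsupp.single b 1), add_tsub_cancel_right,
        add_right_comm]
    · rw [zero_mul]
  have h4 : (if b = i then (1 : ℝ) else 0) * normCoeff (α + Finsupp.single a 1 + Finsupp.single b 1 -
        Finsupp.single i 1 + Finsupp.single j 1) f =
      if b = i then normCoeff (α + Finsupp.single j 1 + Finsupp.single a 1) f else 0 := by
    split_ifs with hbi
    · rw [one_mul, hbi, add_tsub_cancel_right, add_right_comm]
    · rw [zero_mul]
  rw [h1]
  linear_combination θ * h2 + θ * h3 + θ * h4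

end Hessians

/-! ## §4 Proposition 2.7 -/

section Prop27

variable [Fintype σ] [DecidableEq σ]

/-- **The quadratics `∂^α (1 + θ w_i ∂_j) f` have at most one positive eigenvalue** (`f ∈ L^{m+2}_n`, `θ > 0`,
`α ∈ Δ^m_n`) — the heart of the proof of Proposition 2.7, by the three printed cases: `α_i = 0` (one bordering of
`𝓗(∂^α f)` by `u = 𝓗(∂^α f) e_j`); `α_i > 0` and `u = ∇∂^{α+e_j} f ≠ 0` (two borderings, of `𝓗(∂_i F)` by `𝓗(∂_i F) e_j`
and of `θ α_i 𝓗(∂_j F)` by `𝓗(∂_j F) e_i`, `F = ∂^{α-e_i} f`, summed on the common isotropic vector); `α_i > 0` and `u = 0`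
(`𝓗(∂_i F) + θ α_i 𝓗(∂_j F) = 𝓗(D_{e_i + θ α_i e_j} F)` for the cubic `F ∈ L³_n`, Cor. 2.11 / Thm. 2.16 (2):
`sigPos_hessian_dirDeriv_le_one`). [cite: BrandenHuh2019, §2.2 proof of Prop. 2.7 (pp. 13–14)] -/
theorem sigPos_normCoeff_oneAddXPderiv_le_one {m : ℕ} {f : MvPolynomial σ ℝ} (hf : f ∈ lorentzian σ (m + 2))
    {θ : ℝ} (hθ : 0 < θ) (i j : σ) {α : σ →₀ ℕ} (hα : α.degree = m) :
    sigPos (Matrix.toBilin' (Matrix.of fun a b ↦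
      normCoeff (α + Finsupp.single a 1 + Finsupp.single b 1) (oneAddXPderiv θ i j f))).toQuadraticMap ≤ 1 := by
  classical
  have hnn := normCoeff_nonneg_of_mem_lorentzian hf
  have hsig := (mem_lorentzian_iff_forall_sigPos_hessian.1 hf).2
  have he : ∀ k l : σ, 0 ≤ (Pi.single k 1 : σ → ℝ) l := fun k l ↦ by
    rw [Pi.single_apply]; split_ifs <;> norm_num
  -- the linear form `u = ∇ ∂^{α+e_j} f = 𝓗(∂^α f) e_j`
  obtain ⟨u, hu⟩ : ∃ u : σ → ℝ, ∀ k, u k = normCoeff (α + Finsupp.single j 1 + Finsupp.single k 1) f :=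
    ⟨_, fun _ ↦ rfl⟩
  have hH₁nn : ∀ a b, 0 ≤ hessian (iterPderiv α f) a b := fun a b ↦ by
    rw [hessian_iterPderiv]; exact hnn _
  have hH₁u : (hessian (iterPderiv α f)).mulVec (Pi.single j 1) = u := by
    ext a
    rw [Matrix.mulVec_single_one, Matrix.col_apply, hessian_iterPderiv, hu,
      add_right_comm α (Finsupp.single a 1) (Finsupp.single j 1)]
  -- `𝓗(∂^α g) = 𝓗(∂^α f) + θ α_i 𝓗(∂^{α-e_i+e_j} f) + θ (e_i uᵀ + u e_iᵀ)`
  have hmat : (Matrix.of fun a b ↦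
        normCoeff (α + Finsupp.single a 1 + Finsupp.single b 1) (oneAddXPderiv θ i j f)) =
      borderUpdate (hessian (iterPderiv α f) +
        (θ * α i) • hessian (iterPderiv (α - Finsupp.single i 1 + Finsupp.single j 1) f)) θ i u := by
    ext a b
    rw [Matrix.of_apply, borderUpdate_apply, Matrix.add_apply, Matrix.smul_apply, smul_eq_mul, hessian_iterPderiv,
      hessian_iterPderiv, hu, hu, normCoeff_oneAddXPderiv_add_single_add_single]
  rw [hmat]
  by_cases hαi : α i = 0
  · -- Case `α_i = 0`: `∂^α g = ∂^α f + θ w_i ∂^{α+e_j} f`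
    rw [hαi, Nat.cast_zero, mul_zero, zero_smul, add_zero]
    exact sigPos_borderUpdate_le_one_of_mulVec (isSymm_hessian _) (hsig α hα)
      (toBilin'_nonneg_of_nonneg hH₁nn (he j) (he j)) hH₁u θ i
  · -- Case `α_i > 0`: `F = ∂^{α-e_i} f ∈ L³_n`, `𝓗(∂^α f) = 𝓗(∂_i F)`, `𝓗(∂^{α-e_i+e_j} f) = 𝓗(∂_j F)`
    have hc : 0 < θ * α i := mul_pos hθ (Nat.cast_pos.2 (Nat.pos_of_ne_zero hαi))
    have hF : iterPderiv (α - Finsupp.single i 1) f ∈ lorentzian σ 3 := by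
      refine iterPderiv_mem_lorentzian ?_
      have h1 := degree_sub_single_add_one hαi
      have h2 : 3 + (α - Finsupp.single i 1 : σ →₀ ℕ).degree = m + 2 := by omega
      rw [h2]
      exact hf
    have hH₁ : hessian (iterPderiv α f) = hessian (pderiv i (iterPderiv (α - Finsupp.single i 1) f)) := by
      conv_lhs => rw [← Finsupp.sub_add_single_one_cancel hαi, iterPderiv_add_single]
    have hH₂ : hessian (iterPderiv (α - Finsupp.single i 1 + Finsupp.single j 1) f) =
        hessian (pderiv j (iterPderiv (α - Finsupp.single i 1) f)) := by
      rw [iterPderiv_add_single]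
    have hsum : hessian (iterPderiv α f) +
          (θ * α i) • hessian (iterPderiv (α - Finsupp.single i 1 + Finsupp.single j 1) f) =
        hessian (dirDeriv (Pi.single i 1 + (θ * α i) • Pi.single j 1) (iterPderiv (α - Finsupp.single i 1) f)) := by
      rw [hH₁, hH₂, dirDeriv_add, dirDeriv_smul, dirDeriv_single, dirDeriv_single, one_smul, one_smul, hessian_add,
        hessian_smul]
    have h1MN : sigPos (Matrix.toBilin' (hessian (iterPderiv α f) +
        (θ * α i) • hessian (iterPderiv (α - Finsupp.single i 1 + Finsupp.single j 1) f))).toQuadraticMap ≤ 1 := by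
      rw [hsum]
      exact sigPos_hessian_dirDeriv_le_one hF fun k ↦ by
        simp only [Pi.add_apply, Pi.smul_apply, smul_eq_mul]
        exact add_nonneg (he i k) (mul_nonneg hc.le (he j k))
    by_cases hu0 : u = 0
    · -- `∂^{α+e_j} f = 0`: Cor. 2.11 for the cubic `F`
      refine sigPos_borderUpdate_le_one_of_mulVec ((isSymm_hessian _).add ((isSymm_hessian _).smul _)) h1MN
        (b := 0) (by simp) ?_ θ i
      rw [Matrix.mulVec_zero, hu0]
    · -- `∂^{α+e_j} f ≠ 0`: `u = 𝓗(∂_i F) e_j = 𝓗(∂_j F) e_i`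
      have hH₂u : (hessian (iterPderiv (α - Finsupp.single i 1 + Finsupp.single j 1) f)).mulVec (Pi.single i 1) =
          u := by
        ext a
        rw [Matrix.mulVec_single_one, Matrix.col_apply, hessian_iterPderiv, hu,
          add_right_comm (α - Finsupp.single i 1 + Finsupp.single j 1) (Finsupp.single a 1) (Finsupp.single i 1),
          add_right_comm (α - Finsupp.single i 1) (Finsupp.single j 1) (Finsupp.single i 1),
          Finsupp.sub_add_single_one_cancel hαi]
      refine sigPos_borderUpdate_add_le_one (isSymm_hessian _) ((isSymm_hessian _).smul _) (hsig α hα) ?_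
        (toBilin'_nonneg_of_nonneg hH₁nn (he j) (he j)) (b₂ := (θ * α i)⁻¹ • Pi.single i 1) ?_ hH₁u ?_ hu0 θ i
      · -- `θ α_i 𝓗(∂_j F)` has at most one positive square
        rw [map_smul, sigPos_smul_of_pos _ hc]
        exact hsig _ (by rw [degree_sub_single_add_single hαi, hα])
      · exact toBilin'_nonneg_of_nonneg
          (fun a b ↦ by rw [Matrix.smul_apply, smul_eq_mul, hessian_iterPderiv]; exact mul_nonneg hc.le (hnn _))
          (fun k ↦ by rw [Pi.smul_apply, smul_eq_mul]; exact mul_nonneg (inv_nonneg.2 hc.le) (he i k))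
          (fun k ↦ by rw [Pi.smul_apply, smul_eq_mul]; exact mul_nonneg (inv_nonneg.2 hc.le) (he i k))
      · rw [Matrix.smul_mulVec, Matrix.mulVec_smul, smul_smul, mul_inv_cancel₀ hc.ne', one_smul, hH₂u]

/-- **Brändén–Huh, Proposition 2.7: "If `f ∈ L^d_n`, then `(1 + θ w_i ∂_j) f ∈ L^d_n` for every nonnegative real number
`θ`."** For the tree's Definition-2.6 `lorentzian`, via Theorem 2.25's criterion (`mem_lorentzian_iff_forall_sigPos_normCoeff`):
homogeneity and nonnegativity (§1), M-convex support (Lemma 2.8, §2), and the quadratics `∂^α g` (§3,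
`sigPos_normCoeff_oneAddXPderiv_le_one`); `d ≤ 1` and `θ = 0` are immediate.
[cite: BrandenHuh2019, §2.2 Prop. 2.7 (p. 12; proof pp. 13–14)] -/
theorem oneAddXPderiv_mem_lorentzian :
    ∀ {d : ℕ} {f : MvPolynomial σ ℝ}, f ∈ lorentzian σ d → ∀ {θ : ℝ}, 0 ≤ θ → ∀ i j : σ,
      oneAddXPderiv θ i j f ∈ lorentzian σ d
  | 0, _, hf, θ, hθ, i, j =>
    mem_lorentzian_zero.2 ⟨isHomogeneous_oneAddXPderiv θ i j (mem_lorentzian_zero.1 hf).1,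
      coeff_oneAddXPderiv_nonneg hθ i j (mem_lorentzian_zero.1 hf).2⟩
  | 1, _, hf, θ, hθ, i, j =>
    mem_lorentzian_one.2 ⟨isHomogeneous_oneAddXPderiv θ i j (mem_lorentzian_one.1 hf).1,
      coeff_oneAddXPderiv_nonneg hθ i j (mem_lorentzian_one.1 hf).2⟩
  | m + 2, f, hf, θ, hθ, i, j => by
    rcases hθ.eq_or_lt with h0 | hθ'
    · rw [← h0, oneAddXPderiv_zero]
      exact hf
    · have hnn := coeff_nonneg_of_mem_lorentzian hf
      exact mem_lorentzian_iff_forall_sigPos_normCoeff.2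
        ⟨⟨isHomogeneous_oneAddXPderiv θ i j (isHomogeneous_of_mem_lorentzian hf), coeff_oneAddXPderiv_nonneg hθ i j hnn,
          isMConvex_support_oneAddXPderiv hθ i j hnn (isMConvex_support_of_mem_lorentzian hf)⟩,
          fun α hα ↦ sigPos_normCoeff_oneAddXPderiv_le_one hf hθ' i j hα⟩

/-- **Products of the operators `(1 + θ w_i ∂_j)` preserve `L^d_n`** (as a `foldr` over a list of triples
`(θ, i, j)` with `θ ≥ 0`) — the shape in which Proposition 2.7 enters the homotopies of §2.3.
[cite: BrandenHuh2019, §2.2 Prop. 2.7; §2.3 proof of Thm. 2.13 (the operators `T`)] -/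
theorem foldr_oneAddXPderiv_mem_lorentzian {d : ℕ} :
    ∀ (l : List (ℝ × σ × σ)), (∀ p ∈ l, 0 ≤ p.1) → ∀ {f : MvPolynomial σ ℝ}, f ∈ lorentzian σ d →
      l.foldr (fun p g ↦ oneAddXPderiv p.1 p.2.1 p.2.2 g) f ∈ lorentzian σ d
  | [], _, _, hf => by simpa using hf
  | p :: l, hl, f, hf => by
    rw [List.foldr_cons]
    exact oneAddXPderiv_mem_lorentzian
      (foldr_oneAddXPderiv_mem_lorentzian l (fun q hq ↦ hl q (List.mem_cons_of_mem p hq)) hf)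
      (hl p (by simp)) _ _

end Prop27

end Literature.Combinatorics.LorentzianPolynomials

end
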